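import Mathlib
import Summits.MatrixMultiplication.MatrixMultiplication.Theorems.SnSubsetDichotomyPolynomialSlackStructure
import Summits.MatrixMultiplication.MatrixMultiplication.Theorems.SnSubsetDichotomyPolynomialSlackSmallErrors
import Summits.MatrixMultiplication.MatrixMultiplication.Theorems.SnSubsetDichotomyPolynomialSlackFibringGain
import Summits.MatrixMultiplication.MatrixMultiplication.Theorems.SnSubsetDichotomyPolynomialSlackInductionStep
import Summits.MatrixMultiplication.MatrixMultiplication.Theorems.ThresholdSubsetTriples.Negative.Packing
import Summits.MatrixMultiplication.MatrixMultiplication.Theorems.SnSubsetDichotomyPolynomialSlackBalancedThreeQuarters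
import Summits.MatrixMultiplication.MatrixMultiplication.Theorems.SnSubsetDichotomyPolynomialSlackPrintRegime

/-!
# Beyond one half: the crux inequality for every exponent `C < 1/2 + 1/24`

Crux `Summit.MatrixMultiplication.MatrixMultiplication.Theses.SnSubsetDichotomy.PolynomialSlack`
(item `stmt-MatrixMultiplication-8306`; `∀ C ∃ n₀ ∀ n ≥ n₀ ∀ TPP S T U ⊆ S_n, |S||T||U|·n^C ≤ (n!)^{3/2}`),
level-one programme, lead c6. The tree had the inequality for every `C < 1/2` (`polynomialSlack_of_lt_half`,
BCGPU's quasirandomness bound); every lead since named "all triples beyond exponent one half" as the milestone.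
This file proves it for every `C < 1/2 + 1/24` (`slack_of_lt_half_add`), by INDUCTION ON `n`:
with `P(n)` the maximal volume of a TPP triple of `S_n` and `Q(n) = (n!)^{3/2}/P(n)`, the structure theorem
for pure violators (`pure_violator_volume_le`: restricted level-one inequality ⇒ heavy/light reduction of
the level-one equation ⇒ a hub or a heavy cell ⇒ one-point coset fibring over `S_{n-1}`), purification
(`exists_signPure_half`) and the asymptotic side conditions (`eventually_small_errors`, `eventually_gain`)
give `Q(n) ≥ min(n^{C₁}, n^κ·Q(n-1))` for large `n`, and `eventually_le_of_min_le` concludes.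
-/

namespace Summit.MatrixMultiplication.MatrixMultiplication.Theorems.PolynomialSlack

open scoped BigOperators
open Literature.Combinatorics.Additive (TripleProductProperty)

-- `Summit.<Summit>.<Problem>` is the tree's mandated summit-side namespace (CONVENTIONS §2); for
-- this single-conjunct summit the two coincide, so each declaration silences `dupNamespace`.
set_option linter.dupNamespace false

/-- For every `n` there is a MAXIMAL TPP volume `P` in `S_n`: every TPP triple has volume `≤ P`, some TPP
triple has volume `P`, and `P ≥ 1`. [folklore] -/
theorem exists_max_tpp_volume (n : ℕ) : ∃ P : ℕ,
    (∀ S T U : Finset (Equiv.Perm (Fin n)), TripleProductProperty S T U → S.card * T.card * U.card ≤ P) ∧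
    (∃ S T U : Finset (Equiv.Perm (Fin n)), TripleProductProperty S T U ∧ S.card * T.card * U.card = P) ∧
    1 ≤ P := by
  classical
  set vol : Finset (Equiv.Perm (Fin n)) × Finset (Equiv.Perm (Fin n)) × Finset (Equiv.Perm (Fin n)) → ℕ :=
    fun x => x.1.card * x.2.1.card * x.2.2.card with hvol
  set good := (Finset.univ : Finset (Finset (Equiv.Perm (Fin n)) × Finset (Equiv.Perm (Fin n)) ×
    Finset (Equiv.Perm (Fin n)))).filter fun x => TripleProductProperty x.1 x.2.1 x.2.2 with hgood
  have hone : (({1}, {1}, {1}) : Finset (Equiv.Perm (Fin n)) × Finset (Equiv.Perm (Fin n)) ×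
      Finset (Equiv.Perm (Fin n))) ∈ good := by
    rw [hgood, Finset.mem_filter]; exact ⟨Finset.mem_univ _,
      Summit.MatrixMultiplication.MatrixMultiplication.Theorems.ThresholdSubsetTriples.Negative.tpp_singleton_one⟩
  obtain ⟨x, hx, hmax⟩ := Finset.exists_max_image good vol ⟨_, hone⟩
  refine ⟨vol x, fun S T U h => ?_, ⟨x.1, x.2.1, x.2.2, (Finset.mem_filter.1 hx).2, rfl⟩, ?_⟩
  · exact hmax (S, T, U) (by rw [hgood, Finset.mem_filter]; exact ⟨Finset.mem_univ _, h⟩)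
  · have := hmax _ hone
    simpa [hvol] using this

/-- `(n!)^{3/2} = n!·√(n!)` and `(n!)^{3/2} = n^{3/2}·((n-1)!)^{3/2}` for `n ≥ 1`. [folklore] -/
theorem factorial_rpow_three_halves (n : ℕ) :
    (n.factorial : ℝ) ^ ((3 : ℝ) / 2) = n.factorial * Real.sqrt (n.factorial : ℝ) := by
  have hf : (0 : ℝ) ≤ n.factorial := Nat.cast_nonneg _
  rw [show (3 : ℝ) / 2 = 1 + 1 / 2 by norm_num, Real.rpow_add' hf (by norm_num), Real.rpow_one,
    Real.sqrt_eq_rpow]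

set_option maxHeartbeats 1600000 in
/-- **Beyond one half.** For every `C < 1/2 + 1/24` there is `n₀` such that every triple `S, T, U ⊆ S_n`
(`n ≥ n₀`) with the triple product property satisfies `|S||T||U|·n^C ≤ (n!)^{3/2}`. [folklore] -/
theorem slack_of_lt_half_add (C : ℝ) (hC : C < 1 / 2 + 1 / 24) :
    ∃ n₀ : ℕ, ∀ n ≥ n₀, ∀ S T U : Finset (Equiv.Perm (Fin n)), TripleProductProperty S T U →
      ((S.card * T.card * U.card : ℕ) : ℝ) * (n : ℝ) ^ C ≤ (n.factorial : ℝ) ^ ((3 : ℝ) / 2) := by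
  classical
  /- parameters -/
  set e : ℝ := max C (1 / 2) - 1 / 2 with he
  have he0 : 0 ≤ e := by rw [he]; linarith [le_max_right C (1 / 2)]
  have he1 : e < 1 / 24 := by
    rw [he]; have := max_lt hC (by norm_num : (1 : ℝ) / 2 < 1 / 2 + 1 / 24); linarith
  set ε : ℝ := (e + 1 / 24) / 2 with hε
  have hε0 : 0 < ε := by rw [hε]; linarith
  have hε1 : ε < 1 / 24 := by rw [hε]; linarith
  set C₁ : ℝ := 1 / 2 + ε with hC₁
  have hCC₁ : C ≤ C₁ := by
    rw [hC₁]; have := le_max_left C (1 / 2); linarith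
  have hC₁1 : C₁ ≤ 1 := by rw [hC₁]; linarith
  set m : ℝ := ε + 1 / 24 with hm
  have hm0 : 0 < m := by rw [hm]; linarith
  set κ : ℝ := (1 / 4 - 6 * ε) / 4 with hκ
  have hκ0 : 0 < κ := by rw [hκ]; linarith
  /- thresholds -/
  obtain ⟨na, hna⟩ := eventually_small_errors ε hε0 hε1 C₁ m rfl rfl
  obtain ⟨nb, hnb⟩ := eventually_gain ε hε0 hε1 m κ rfl rfl
  obtain ⟨nc, hnc⟩ := polynomialSlack_of_lt_half 0 (by norm_num)
  /- the maximal volumes -/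
  choose P hP using exists_max_tpp_volume
  have hP1 : ∀ n, (1 : ℝ) ≤ P n := fun n => by exact_mod_cast (hP n).2.2
  have hP0 : ∀ n, (0 : ℝ) < P n := fun n => lt_of_lt_of_le one_pos (hP1 n)
  have hPle : ∀ n, nc ≤ n → (P n : ℝ) ≤ (n.factorial : ℝ) ^ ((3 : ℝ) / 2) := by
    intro n hn
    obtain ⟨S, T, U, hTPP, hvol⟩ := (hP n).2.1
    have h := hnc n hn S T U hTPP
    rw [Real.rpow_zero, mul_one, hvol] at h
    exact h
  set Q : ℕ → ℝ := fun n => max 1 ((n.factorial : ℝ) ^ ((3 : ℝ) / 2) / P n) with hQ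
  have hQ1 : ∀ n, 1 ≤ Q n := fun n => le_max_left _ _
  have hQe : ∀ n, nc ≤ n → Q n = (n.factorial : ℝ) ^ ((3 : ℝ) / 2) / P n := by
    intro n hn
    rw [hQ]; dsimp only
    exact max_eq_right (by rw [le_div_iff₀ (hP0 n), one_mul]; exact hPle n hn)
  /- the step -/
  set n₁ : ℕ := max (max na nb) (nc + 1) with hn₁
  have hstep : ∀ n : ℕ, n₁ ≤ n → min (1 * (n : ℝ) ^ C₁) ((n : ℝ) ^ κ * Q (n - 1)) ≤ Q n := by
    intro n hn
    have hna' : na ≤ n := le_trans (le_trans (le_max_left _ _) (le_max_left _ _)) hn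
    have hnb' : nb ≤ n := le_trans (le_trans (le_max_right _ _) (le_max_left _ _)) hn
    have hnc' : nc ≤ n := by have := le_trans (le_max_right _ _) hn; omega
    have hnc'' : nc ≤ n - 1 := by have := le_trans (le_max_right _ _) hn; omega
    obtain ⟨h40, hM3, hsmall⟩ := hna n hna'
    have hgain := hnb n hnb'
    have hn1 : 1 ≤ n := by omega
    have hnR : (1 : ℝ) ≤ n := by exact_mod_cast hn1
    have hn0 : (0 : ℝ) < n := by linarith
    have hf0 : (0 : ℝ) < n.factorial := by exact_mod_cast n.factorial_pos
    rw [hQe n hnc']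
    -- the extremal triple at `n`
    obtain ⟨S, T, U, hTPP, hvol⟩ := (hP n).2.1
    by_cases hcase : (P n : ℝ) * (n : ℝ) ^ C₁ ≤ (n.factorial : ℝ) ^ ((3 : ℝ) / 2)
    · -- no violator: `Q n ≥ n^{C₁}`
      refine le_trans (min_le_left _ _) ?_
      rw [one_mul, le_div_iff₀ (hP0 n), mul_comm]
      exact hcase
    · -- a violator: purify and fibre
      rw [not_le] at hcase
      refine le_trans (min_le_right _ _) ?_
      obtain ⟨S', hS'S, hS'p, hS'c⟩ := exists_signPure_half S
      obtain ⟨T', hT'T, hT'p, hT'c⟩ := exists_signPure_half T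
      obtain ⟨U', hU'U, hU'p, hU'c⟩ := exists_signPure_half U
      have hTPP' : TripleProductProperty S' T' U' := hTPP.mono hS'S hT'T hU'U
      have hvolpos : 0 < S.card * T.card * U.card := by rw [hvol]; exact (hP n).2.2
      have hSpos : 0 < S.card := Nat.pos_of_mul_pos_right (Nat.pos_of_mul_pos_right hvolpos)
      have hTpos : 0 < T.card := Nat.pos_of_mul_pos_left (Nat.pos_of_mul_pos_right hvolpos)
      have hUpos : 0 < U.card := Nat.pos_of_mul_pos_left hvolpos
      have hS'0 : S'.Nonempty := Finset.card_pos.1 (by omega)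
      have hT'0 : T'.Nonempty := Finset.card_pos.1 (by omega)
      have hU'0 : U'.Nonempty := Finset.card_pos.1 (by omega)
      have h8 : ((S.card * T.card * U.card : ℕ) : ℝ) ≤ 8 * (S'.card * T'.card * U'.card : ℕ) := by
        have : S.card * T.card * U.card ≤ 8 * (S'.card * T'.card * U'.card) := by
          calc S.card * T.card * U.card ≤ (2 * S'.card) * (2 * T'.card) * (2 * U'.card) :=
                Nat.mul_le_mul (Nat.mul_le_mul hS'c hT'c) hU'c
            _ = 8 * (S'.card * T'.card * U'.card) := by ring
        exact_mod_cast this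
      have hviol : (n.factorial : ℝ) * Real.sqrt (n.factorial : ℝ) ≤
          8 * (S'.card * T'.card * U'.card : ℕ) * (n : ℝ) ^ C₁ := by
        rw [← factorial_rpow_three_halves]
        have h1 : (n.factorial : ℝ) ^ ((3 : ℝ) / 2) ≤ (P n : ℝ) * (n : ℝ) ^ C₁ := hcase.le
        rw [← hvol] at h1
        have h2 : ((S.card * T.card * U.card : ℕ) : ℝ) * (n : ℝ) ^ C₁ ≤
            8 * (S'.card * T'.card * U'.card : ℕ) * (n : ℝ) ^ C₁ :=
          mul_le_mul_of_nonneg_right h8 (by positivity)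
        linarith
      have hM1 : (1 : ℝ) ≤ (n : ℝ) ^ m := Real.one_le_rpow hnR hm0.le
      have hstruct := pure_violator_volume_le h40 (P (n - 1)) (hP (n - 1)).1 hTPP' hS'0 hT'0 hU'0 hS'p hT'p
        hU'p C₁ ((n : ℝ) ^ m) hC₁1 hM1 hviol hM3 hsmall
      -- `P n ≤ 8 N' ≤ n^{3/2-κ} P(n-1)`
      have hPn1 : 0 ≤ (P (n - 1) : ℝ) := (hP0 (n - 1)).le
      have hmain : (P n : ℝ) ≤ (n : ℝ) ^ ((3 : ℝ) / 2 - κ) * P (n - 1) := by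
        rw [← hvol]
        have h1 := mul_le_mul_of_nonneg_left hstruct (by norm_num : (0 : ℝ) ≤ 8)
        have h2 := mul_le_mul_of_nonneg_right hgain hPn1
        calc ((S.card * T.card * U.card : ℕ) : ℝ) ≤ 8 * (S'.card * T'.card * U'.card : ℕ) := h8
          _ ≤ _ := h1
          _ = 8 * (100 * (200 * (1 + Real.log n) * Real.log (256 * (n : ℝ) ^ 3)) ^ 3 *
                (64 * (n : ℝ) ^ 2 * ((n : ℝ) ^ m) ^ 3) ^ 2 / ((n : ℝ) - 1) ^ 3 +
                (n : ℝ) * (1024 * (n : ℝ) * ((n : ℝ) ^ m) ^ 3) ^ 2 / ((n : ℝ) - 1) ^ 2) * P (n - 1) := by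
              ring
          _ ≤ (n : ℝ) ^ ((3 : ℝ) / 2 - κ) * P (n - 1) := h2
      -- translate to `Q`
      rw [hQe (n - 1) hnc'']
      have hfac : (n.factorial : ℝ) ^ ((3 : ℝ) / 2) =
          (n : ℝ) ^ ((3 : ℝ) / 2) * ((n - 1).factorial : ℝ) ^ ((3 : ℝ) / 2) := by
        rw [← Real.mul_rpow hn0.le (Nat.cast_nonneg _)]
        congr 1
        have : n = (n - 1) + 1 := by omega
        conv_lhs => rw [this, Nat.factorial_succ]
        push_cast
        rw [Nat.cast_sub hn1]; ring
      have hsplit : (n : ℝ) ^ ((3 : ℝ) / 2) = (n : ℝ) ^ κ * (n : ℝ) ^ ((3 : ℝ) / 2 - κ) := by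
        rw [← Real.rpow_add hn0]; congr 1; ring
      rw [hfac, hsplit]
      have hpow0 : 0 < (n : ℝ) ^ ((3 : ℝ) / 2 - κ) := Real.rpow_pos_of_pos hn0 _
      have hpowκ : 0 < (n : ℝ) ^ κ := Real.rpow_pos_of_pos hn0 _
      rw [le_div_iff₀ (hP0 n)]
      calc (n : ℝ) ^ κ * (((n - 1).factorial : ℝ) ^ ((3 : ℝ) / 2) / P (n - 1)) * P n
          ≤ (n : ℝ) ^ κ * (((n - 1).factorial : ℝ) ^ ((3 : ℝ) / 2) / P (n - 1)) *
            ((n : ℝ) ^ ((3 : ℝ) / 2 - κ) * P (n - 1)) :=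
            mul_le_mul_of_nonneg_left hmain (by positivity)
        _ = (n : ℝ) ^ κ * (n : ℝ) ^ ((3 : ℝ) / 2 - κ) * ((n - 1).factorial : ℝ) ^ ((3 : ℝ) / 2) := by
            have hP' := (hP0 (n - 1)).ne'
            field_simp
  /- the induction -/
  obtain ⟨n₂, hn₂⟩ := eventually_le_of_min_le Q 1 C₁ κ one_pos hκ0 n₁ hQ1 hstep
  refine ⟨max n₂ (max nc 1), fun n hn S T U hTPP => ?_⟩
  have hn2' : n₂ ≤ n := le_trans (le_max_left _ _) hn
  have hnc' : nc ≤ n := le_trans (le_trans (le_max_left _ _) (le_max_right _ _)) hn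
  have hn1 : 1 ≤ n := le_trans (le_trans (le_max_right _ _) (le_max_right _ _)) hn
  have hnR : (1 : ℝ) ≤ n := by exact_mod_cast hn1
  have h := hn₂ n hn2'
  rw [one_mul, hQe n hnc', le_div_iff₀ (hP0 n)] at h
  have hvol : ((S.card * T.card * U.card : ℕ) : ℝ) ≤ P n := by exact_mod_cast (hP n).1 S T U hTPP
  have hCC : (n : ℝ) ^ C ≤ (n : ℝ) ^ C₁ := Real.rpow_le_rpow_of_exponent_le hnR hCC₁
  calc ((S.card * T.card * U.card : ℕ) : ℝ) * (n : ℝ) ^ C ≤ (P n : ℝ) * (n : ℝ) ^ C₁ :=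
        mul_le_mul hvol hCC (by positivity) (hP0 n).le
    _ = (n : ℝ) ^ C₁ * P n := mul_comm _ _
    _ ≤ (n.factorial : ℝ) ^ ((3 : ℝ) / 2) := h

end Summit.MatrixMultiplication.MatrixMultiplication.Theorems.PolynomialSlack
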